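import Literature.MathematicalPhysics.QuantumFieldTheory.Balaban1983to89.B15Prop1DatumCoordinates
import Literature.MathematicalPhysics.QuantumFieldTheory.Balaban1983to89.B15Prop1SecondVariationAlongChart

/-!
# `Balaban1983to89.B15Prop1LinearisedDatumCoordinates` — [Balaban1985Variational] = «[15]», Sect. C (45)–(48) p. 285, (82)–(83) p. 290, Sect. G p. 305; [Balaban1988Convergent] (2.10)–(2.11) p. 256;
# [Balaban1985Averaging] (21) p. 21:  THE LINEARISED DATUM COORDINATES ALONG A CHART LINE — `DΦ₀(0)` on a real direction `cplxVec p` is the logarithmic-coordinate image of the VELOCITY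
# `W_j(c)⋆ · d/ds|₀ Ū^j(exp(s p)·U₀)(c)` of the relative average: the junction between the complex constraint derivative of `B15Prop1LocalChartAtBaseField` (`honto`, and the kernel in
# `hnondeg` ∕ `hcrit`) and the linearised-averaging letters of n07-w2 ∕ n10-w1 ([15] (45) «L^jηQ_jHB = B», velocity currency)

Honest framing: statement-level skeleton of published theorems with citation tags; proofs where landed; nothing here is a claim about the
Yang–Mills mass gap.  Cell `pub-ymgap`, HUMAN RULING D-0149 (width seats), seat `pub-ymgap-dag-n12-w1` (g2; N12 = [B15]; U1a⁺ of the w1 lineage);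
count-neutral; N12 NOT discharged; finite 𝕋⁴ at fixed ε; nothing continuum ∕ OS ∕ mass-gap ∕ Clay.

CONTENTS (theorems only; no `def`, no `instance`, no `sorry`).  §1 `exists_logCoordCLM` (the linear part `M ↦ (−½ tr(E_a M))_a` of `logCoordC` as a continuous linear map — existence),
★ `hasFDerivAt_logCoordC_one` (`D logCoordC (1)` is that map: `D log(1) = id`, `B7TransferAnalyticMean.hasFDerivAt_mlog_one`).  §2 `coeField_expMul_smul` (the real chart line in complex
coordinates), `tendsto_coeField_expMul_smul`, `eventually_datumCoord_chart_eq_model` (near `s = 0` the complex coordinate curve IS the logarithmic coordinate of the real relative average),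
★★ `fderiv_datumCoord_expMulC_apply_of_hasDerivAt` (from the velocity letter `hv : HasDerivAt (s ↦ ↑Ū^j(exp(s p)·U₀)(c)) v 0`: `DΦ₀(0)(cplxVec p)_i = T (W_j(c)⋆ · v)`), and its coordinate form
`fderiv_datumCoord_expMulC_apply_coord` (`= −½ tr(E_a · W⋆v)`).
-/

noncomputable section

namespace Literature.MathematicalPhysics.QuantumFieldTheory.Balaban1983to89.B15Prop1LinearisedDatumCoordinates

open Set Filter
open scoped Topology ContDiff ComplexConjugate
open Literature.Analysis.Calculus.LagrangeHessianRealCoercive (hasDerivAt_comp_realLine)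
open Literature.MathematicalPhysics.QuantumFieldTheory.Balaban1983to89.Node00 (SU coeField coeField_apply SmallBelow ConstrSet constrCard constrEnum star_coe_mul_coe_SU)
open B15AveragingHolomorphic (iterMh coeField_iter_eq_iterMh)
open B15SU2ChartHolomorphic (genE expMulC logCoordC logCoordC_apply)
open B15Prop1StateChartSU2 (analyticAt_expMulC_right expMulC_cplxVec_coeField_eq)
open B15Prop1DatumCoordinates (eventually_smallBelow eventually_analyticAt_datumCoord star_coe_mul_iterMh_coeField expMulC_zero_left)
open B15Prop1HessianNondegenerateOfRealCoercive (cplxVec_smul)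
open B15Prop1AnalyticExtClause (cplxVec)
open B15Prop1ChartCalculusSU2 (E3)
open B15Prop1ChartSU2 (su2Chart)
open B16Sect1Backgrounds (expMul expMul_zero)
open MatrixLog (mlog)
open ExpMeanLog (expMeanLogSU)
open BlockAveraging (blockAvg)
open T4CubeChartGnomonic (SU2)
open T4Continuum B15DeterminingSets GaugeField
open scoped Matrix.Norms.L2Operator

/-! ## §1  The derivative of the logarithmic coordinates at `1` -/

section LogDeriv

/-- **THE LINEAR PART OF THE LOGARITHMIC COORDINATES** `M ↦ (−½ tr(E_a · M))_a ∈ ℂ³` as a continuous linear map (existence; no new definition). [cite: Balaban1985Averaging, (21) p.21 (bookkeeping)] -/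
theorem exists_logCoordCLM : ∃ T : Matrix (Fin 2) (Fin 2) ℂ →L[ℂ] EuclideanSpace ℂ (Fin 3), ∀ M a, T M a = -(1 / 2 : ℂ) * (genE a * M).trace := by
  let e : EuclideanSpace ℂ (Fin 3) ≃L[ℂ] (Fin 3 → ℂ) := PiLp.continuousLinearEquiv 2 ℂ (fun _ : Fin 3 => ℂ)
  let Tpi : Matrix (Fin 2) (Fin 2) ℂ →L[ℂ] (Fin 3 → ℂ) := ContinuousLinearMap.pi fun a =>
    (-(1 / 2 : ℂ)) • LinearMap.toContinuousLinearMap ((Matrix.traceLinearMap (Fin 2) ℂ ℂ).comp (LinearMap.mulLeft ℂ (genE a)))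
  refine ⟨(e.symm : (Fin 3 → ℂ) →L[ℂ] EuclideanSpace ℂ (Fin 3)).comp Tpi, fun M a => ?_⟩
  rfl

/-- ★ **`D logCoordC (1) = T`** (`logCoordC = T ∘ log` with `T` the linear part and `D log(1) = id`). [cite: Balaban1985Averaging, (21) p.21; Balaban1989LargeFieldII, (1.19) p.360] -/
theorem hasFDerivAt_logCoordC_one {T : Matrix (Fin 2) (Fin 2) ℂ →L[ℂ] EuclideanSpace ℂ (Fin 3)} (hT : ∀ M a, T M a = -(1 / 2 : ℂ) * (genE a * M).trace) :
    HasFDerivAt logCoordC T (1 : Matrix (Fin 2) (Fin 2) ℂ) := by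
  have hfun : logCoordC = (T : Matrix (Fin 2) (Fin 2) ℂ → EuclideanSpace ℂ (Fin 3)) ∘ (mlog : Matrix (Fin 2) (Fin 2) ℂ → Matrix (Fin 2) (Fin 2) ℂ) := by
    funext A; ext a
    rw [logCoordC_apply, Function.comp_apply, hT]
  rw [hfun]
  have h := T.hasFDerivAt.comp (1 : Matrix (Fin 2) (Fin 2) ℂ) (B7TransferAnalyticMean.hasFDerivAt_mlog_one (𝔄 := Matrix (Fin 2) (Fin 2) ℂ))
  rwa [ContinuousLinearMap.one_def, ContinuousLinearMap.comp_id] at h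

end LogDeriv

/-! ## §2  The linearised datum coordinates along a real chart line -/

section Linearised

variable {P : Params}

/-- The real chart line in complex coordinates: `↑(exp(s p)·U₀) = expMulC (0 + s • cplxVec p) ↑U₀`. [cite: Balaban1989LargeFieldI, Prop. 1 p.194 (bookkeeping)] -/
theorem coeField_expMul_smul (U₀ : GaugeField P 0 SU2) (p : VecField P 0 E3) (s : ℝ) :
    coeField (expMul su2Chart (s • p) U₀) = expMulC ((0 : VecField P 0 (EuclideanSpace ℂ (Fin 3))) + (s : ℂ) • cplxVec p) (coeField U₀) := by
  rw [zero_add, ← cplxVec_smul, expMulC_cplxVec_coeField_eq]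

/-- The real chart line is continuous into matrix fields and starts at `↑U₀`. [cite: Balaban1989LargeFieldI, Prop. 1 p.194 (bookkeeping)] -/
theorem tendsto_coeField_expMul_smul (U₀ : GaugeField P 0 SU2) (p : VecField P 0 E3) :
    Tendsto (fun s : ℝ => coeField (expMul su2Chart (s • p) U₀)) (𝓝 0) (𝓝 (coeField U₀)) := by
  have hc : ContinuousAt (fun s : ℝ => expMulC ((0 : VecField P 0 (EuclideanSpace ℂ (Fin 3))) + (s : ℂ) • cplxVec p) (coeField U₀)) 0 :=
    (analyticAt_expMulC_right (coeField U₀) _).continuousAt.comp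
      (continuous_const.add (Complex.continuous_ofReal.smul continuous_const)).continuousAt
  have h := hc.tendsto
  simp only [Complex.ofReal_zero, zero_smul, add_zero, expMulC_zero_left] at h
  refine h.congr' (Eventually.of_forall fun s => ?_)
  exact (coeField_expMul_smul U₀ p s).symm

variable (𝔹 : DetSet P) (k : ℕ) (W : MSField P SU2)
  (κ : (PBond P 0 → Matrix (Fin 2) (Fin 2) ℂ) → Fin (constrCard 𝔹 k) → EuclideanSpace ℂ (Fin 3))
  (hκ : ∀ Q i, κ Q i = logCoordC (star ((W ((constrEnum 𝔹 k).symm i).1 ((constrEnum 𝔹 k).symm i).2.1 : SU2) : Matrix (Fin 2) (Fin 2) ℂ) *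
    iterMh ((constrEnum 𝔹 k).symm i).1 Q ((constrEnum 𝔹 k).symm i).2.1))
include hκ

/-- **NEAR `s = 0` THE COMPLEX COORDINATE CURVE ALONG THE CHART LINE IS THE LOGARITHMIC COORDINATE OF THE REAL RELATIVE AVERAGE** (the chart configuration stays guarded; there the
holomorphic iterate is the averaging of record). [cite: Balaban1988Convergent, (2.10)–(2.11) p.256; Balaban1987RG1, (0.4) p.253] -/
theorem eventually_datumCoord_chart_eq_model {U₀ : GaugeField P 0 SU2} (hsb : SmallBelow (fun j => blockAvg (P := P) (j := j) expMeanLogSU) k U₀)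
    (p : VecField P 0 E3) (i : Fin (constrCard 𝔹 k)) :
    ∀ᶠ s : ℝ in 𝓝 0, κ (expMulC ((0 : VecField P 0 (EuclideanSpace ℂ (Fin 3))) + (s : ℂ) • cplxVec p) (coeField U₀)) i =
      logCoordC (star ((W ((constrEnum 𝔹 k).symm i).1 ((constrEnum 𝔹 k).symm i).2.1 : SU2) : Matrix (Fin 2) (Fin 2) ℂ) *
        ((avgFamily (fun j => blockAvg (P := P) (j := j) expMeanLogSU) (expMul su2Chart (s • p) U₀) ((constrEnum 𝔹 k).symm i).1
          ((constrEnum 𝔹 k).symm i).2.1 : SU2) : Matrix (Fin 2) (Fin 2) ℂ)) := by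
  filter_upwards [(tendsto_coeField_expMul_smul U₀ p).eventually (eventually_smallBelow hsb)] with s hs
  have hguard := hs (expMul su2Chart (s • p) U₀) rfl
  rw [← coeField_expMul_smul, hκ, star_coe_mul_iterMh_coeField k W hguard (Nat.lt_succ_iff.1 ((constrEnum 𝔹 k).symm i).1.2)]

/-- ★★ **THE LINEARISED DATUM COORDINATES ALONG A CHART LINE.**  At a base configuration `U₀` on the fibre of `W` (guarded below `k`), for a real direction `p` and a constrained bond
`(j,c)` with VELOCITY `v = d/ds|₀ ↑Ū^j(exp(s p)·U₀)(c)` (hypothesis `hv`, the currency of n07-w2's right-inverse letter), the derivative of the complex constraint coordinates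
`Φ₀ X = κ (expMulC X ↑U₀)` at `0` in the direction `cplxVec p` has `i`-th component `T (W_j(c)⋆ · v)`, `T` the linear part of the logarithmic coordinates.
[cite: Balaban1985Variational, Sect. C (45)–(48) p.285, (82)–(83) p.290; Balaban1988Convergent, (2.10)–(2.11) p.256; Balaban1985Averaging, (21) p.21] -/
theorem fderiv_datumCoord_expMulC_apply_of_hasDerivAt {U₀ : GaugeField P 0 SU2} (hsb : SmallBelow (fun j => blockAvg (P := P) (j := j) expMeanLogSU) k U₀)
    (hU : AgreeOn 𝔹 (avgFamily (fun j => blockAvg (P := P) (j := j) expMeanLogSU) U₀) W)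
    {T : Matrix (Fin 2) (Fin 2) ℂ →L[ℂ] EuclideanSpace ℂ (Fin 3)} (hT : ∀ M a, T M a = -(1 / 2 : ℂ) * (genE a * M).trace)
    (p : VecField P 0 E3) (i : Fin (constrCard 𝔹 k)) {v : Matrix (Fin 2) (Fin 2) ℂ}
    (hv : HasDerivAt (fun s : ℝ => ((avgFamily (fun j => blockAvg (P := P) (j := j) expMeanLogSU) (expMul su2Chart (s • p) U₀) ((constrEnum 𝔹 k).symm i).1
      ((constrEnum 𝔹 k).symm i).2.1 : SU2) : Matrix (Fin 2) (Fin 2) ℂ)) v 0) :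
    fderiv ℂ (fun X : VecField P 0 (EuclideanSpace ℂ (Fin 3)) => κ (expMulC X (coeField U₀))) 0 (cplxVec p) i =
      T (star ((W ((constrEnum 𝔹 k).symm i).1 ((constrEnum 𝔹 k).symm i).2.1 : SU2) : Matrix (Fin 2) (Fin 2) ℂ) * v) := by
  set s₀ := (constrEnum 𝔹 k).symm i with hs₀
  set Ws : Matrix (Fin 2) (Fin 2) ℂ := star ((W s₀.1 s₀.2.1 : SU2) : Matrix (Fin 2) (Fin 2) ℂ) with hWs
  -- `Φ₀` is analytic at `0` (`κ` analytic near `↑U₀`, the chart analytic with `expMulC 0 ↑U₀ = ↑U₀`)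
  have hκan : AnalyticAt ℂ κ (coeField U₀) := (eventually_analyticAt_datumCoord 𝔹 k W κ hκ hsb hU).self_of_nhds
  have hΦ : DifferentiableAt ℂ (fun X : VecField P 0 (EuclideanSpace ℂ (Fin 3)) => κ (expMulC X (coeField U₀))) 0 := by
    have h1 : AnalyticAt ℂ κ (expMulC (0 : VecField P 0 (EuclideanSpace ℂ (Fin 3))) (coeField U₀)) := by rw [expMulC_zero_left]; exact hκan
    exact (AnalyticAt.comp (f := fun X : VecField P 0 (EuclideanSpace ℂ (Fin 3)) => expMulC X (coeField U₀)) (x := 0) h1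
      (analyticAt_expMulC_right (coeField U₀) 0)).differentiableAt
  -- the derivative along the ray, component `i`
  have hray := hasDerivAt_comp_realLine (x₀ := (0 : VecField P 0 (EuclideanSpace ℂ (Fin 3)))) (cplxVec p) hΦ
  have hrayi : HasDerivAt (fun t : ℝ => κ (expMulC ((0 : VecField P 0 (EuclideanSpace ℂ (Fin 3))) + (t : ℂ) • cplxVec p) (coeField U₀)) i)
      (fderiv ℂ (fun X : VecField P 0 (EuclideanSpace ℂ (Fin 3)) => κ (expMulC X (coeField U₀))) 0 (cplxVec p) i) 0 :=
    (hasDerivAt_pi.1 hray) i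
  -- the model curve `t ↦ logCoordC (W⋆ · ↑Ū(exp(t p)·U₀))` and its derivative
  have hm : HasDerivAt (fun t : ℝ => Ws * ((avgFamily (fun j => blockAvg (P := P) (j := j) expMeanLogSU) (expMul su2Chart (t • p) U₀) s₀.1 s₀.2.1 : SU2) :
      Matrix (Fin 2) (Fin 2) ℂ)) (Ws * v) 0 := hv.const_mul Ws
  have hm0 : Ws * ((avgFamily (fun j => blockAvg (P := P) (j := j) expMeanLogSU) (expMul su2Chart ((0 : ℝ) • p) U₀) s₀.1 s₀.2.1 : SU2) :
      Matrix (Fin 2) (Fin 2) ℂ) = 1 := by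
    rw [zero_smul, expMul_zero, hU _ _ s₀.2.2, hWs, star_coe_mul_coe_SU]
  have hlog : HasDerivAt (fun t : ℝ => logCoordC (Ws * ((avgFamily (fun j => blockAvg (P := P) (j := j) expMeanLogSU) (expMul su2Chart (t • p) U₀) s₀.1 s₀.2.1 :
      SU2) : Matrix (Fin 2) (Fin 2) ℂ))) (T (Ws * v)) 0 := by
    have hD : HasFDerivAt logCoordC (T.restrictScalars ℝ)
        (Ws * ((avgFamily (fun j => blockAvg (P := P) (j := j) expMeanLogSU) (expMul su2Chart ((0 : ℝ) • p) U₀) s₀.1 s₀.2.1 : SU2) : Matrix (Fin 2) (Fin 2) ℂ)) := by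
      rw [hm0]; exact (hasFDerivAt_logCoordC_one hT).restrictScalars ℝ
    have h := hD.comp_hasDerivAt (0 : ℝ) hm
    exact h
  -- the true component curve equals the model near `0`
  have heq : (fun t : ℝ => κ (expMulC ((0 : VecField P 0 (EuclideanSpace ℂ (Fin 3))) + (t : ℂ) • cplxVec p) (coeField U₀)) i) =ᶠ[𝓝 0]
      fun t : ℝ => logCoordC (Ws * ((avgFamily (fun j => blockAvg (P := P) (j := j) expMeanLogSU) (expMul su2Chart (t • p) U₀) s₀.1 s₀.2.1 : SU2) :
        Matrix (Fin 2) (Fin 2) ℂ)) :=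
    eventually_datumCoord_chart_eq_model 𝔹 k W κ hκ hsb p i
  exact hrayi.unique (hlog.congr_of_eventuallyEq heq)

/-- The coordinate form: `(DΦ₀(0)(cplxVec p))_{i,a} = −½ tr(E_a · W_j(c)⋆ · v)`. [cite: Balaban1985Variational, Sect. C (47)–(48) p.285; Balaban1985Averaging, (21) p.21] -/
theorem fderiv_datumCoord_expMulC_apply_coord {U₀ : GaugeField P 0 SU2} (hsb : SmallBelow (fun j => blockAvg (P := P) (j := j) expMeanLogSU) k U₀)
    (hU : AgreeOn 𝔹 (avgFamily (fun j => blockAvg (P := P) (j := j) expMeanLogSU) U₀) W)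
    (p : VecField P 0 E3) (i : Fin (constrCard 𝔹 k)) {v : Matrix (Fin 2) (Fin 2) ℂ}
    (hv : HasDerivAt (fun s : ℝ => ((avgFamily (fun j => blockAvg (P := P) (j := j) expMeanLogSU) (expMul su2Chart (s • p) U₀) ((constrEnum 𝔹 k).symm i).1
      ((constrEnum 𝔹 k).symm i).2.1 : SU2) : Matrix (Fin 2) (Fin 2) ℂ)) v 0) (a : Fin 3) :
    fderiv ℂ (fun X : VecField P 0 (EuclideanSpace ℂ (Fin 3)) => κ (expMulC X (coeField U₀))) 0 (cplxVec p) i a =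
      -(1 / 2 : ℂ) * (genE a * (star ((W ((constrEnum 𝔹 k).symm i).1 ((constrEnum 𝔹 k).symm i).2.1 : SU2) : Matrix (Fin 2) (Fin 2) ℂ) * v)).trace := by
  obtain ⟨T, hT⟩ := exists_logCoordCLM
  rw [fderiv_datumCoord_expMulC_apply_of_hasDerivAt 𝔹 k W κ hκ hsb hU hT p i hv, hT]

end Linearised

end Literature.MathematicalPhysics.QuantumFieldTheory.Balaban1983to89.B15Prop1LinearisedDatumCoordinates

end
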